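import Mathlib
import Summits.KontsevichZagierPeriods.KontsevichZagierPeriods.Theses.InverseLandau

/-!
# `TateLifting`, line `Sketch`, stub `stub_arcSpecialisation` — generic fibres are Tate fibres

Crux stmt-KontsevichZagierPeriods-9129 (`Summit.KontsevichZagierPeriods.KontsevichZagierPeriods.Theses.InverseLandau.TateLifting`).
Assuming the three elementary statements `CornerShift`, `PolynomialArc`, `TateSubst` (stubs of the
same line, proved separately and taken here as hypotheses, verbatim), every GENERIC FIBRE — the
specialisation `[(0,1)ⁿ, P/Q(·;a)]` of a `k`-parameter rational vanishing identity with a Tate corner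
(`Q(z;0) ≡ c₀ ≠ 0`, `Q ≠ 0` on `[0,1]ⁿ × U`, `∫ P/Q(z;u) dz = 0` for `u ∈ U`, `U` open) at a point `a`
with real-algebraic coordinates joined to the corner by a path in `U` — is a TATE FIBRE in the sense of
the crux: with `θ` from `CornerShift`, the arc `p` from `PolynomialArc` (path `t ↦ γ(t/θ)`), a margin
`δ > 0` with `p((θ−δ, θ+δ)) ⊆ U` (continuity at `θ`, `U` open), and `P' Q'` from `TateSubst`, the data
`(n, P', Q', ε := θ + δ, ϖ₀ := θ, r)` witness membership: `Q'(z,0) = Q(z;p(0)) = Q(z;0) = c₀`,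
admissibility and vanishing on `(0, ε)` because `p(ϖ) ∈ U` there, and the fibre at `θ` is
`P/Q(·; p(θ)) = P/Q(·; a)`, the integrand of `r` itself.
-/

noncomputable section

namespace Summit.KontsevichZagierPeriods.InverseLandau

open Literature.NumberTheory.Transcendental

/-- **Arc specialisation** (stub `stub_arcSpecialisation` of line `Sketch` for crux `TateLifting`):
`CornerShift → PolynomialArc → TateSubst → genFibres ⊆ tateFibres`, all four written out. [folklore] -/
theorem tateLifting_arcSpecialisation :
    -- CornerShift
    (∀ (k : ℕ) (a : Fin k → ℝ), (∀ j, IsAlgebraic ℚ (a j)) →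
      ∃ θ : ℝ, IsAlgebraic ℚ θ ∧ 0 < θ ∧
        (∀ t ∈ Set.Ioo (0 : ℝ) θ, Polynomial.aeval t (minpoly ℚ θ) ≠ 0) ∧
        ∀ j, ∃ q : Polynomial ℚ, Polynomial.aeval θ q = a j) →
    -- PolynomialArc
    (∀ (k : ℕ) (θ : ℝ) (a : Fin k → ℝ) (U : Set (Fin k → ℝ)) (γ : ℝ → (Fin k → ℝ)),
      IsAlgebraic ℚ θ → 0 < θ → (∀ t ∈ Set.Ioo (0 : ℝ) θ, Polynomial.aeval t (minpoly ℚ θ) ≠ 0) →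
      (∀ j, ∃ q : Polynomial ℚ, Polynomial.aeval θ q = a j) → IsOpen U →
      ContinuousOn γ (Set.Icc 0 θ) → γ 0 = 0 → γ θ = a → (∀ t ∈ Set.Icc (0 : ℝ) θ, γ t ∈ U) →
      ∃ p : Fin k → Polynomial ℚ, (∀ j, Polynomial.aeval (0 : ℝ) (p j) = 0) ∧
        (∀ j, Polynomial.aeval θ (p j) = a j) ∧
        ∀ t ∈ Set.Icc (0 : ℝ) θ, (fun j => Polynomial.aeval t (p j)) ∈ U) →
    -- TateSubst
    (∀ (n k : ℕ) (p : Fin k → Polynomial ℚ) (R : MvPolynomial (Fin (n + k)) ℚ),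
      ∃ R' : MvPolynomial (Fin (n + 1)) ℚ, ∀ (z : Fin n → ℝ) (ϖ : ℝ),
        MvPolynomial.aeval (Fin.snoc z ϖ : Fin (n + 1) → ℝ) R' =
          MvPolynomial.aeval (Fin.append z (fun j => Polynomial.aeval ϖ (p j))) R) →
    -- genFibres ⊆ tateFibres
    {d : KZ.FormalRep | ∃ (n k : ℕ) (P Q : MvPolynomial (Fin (n + k)) ℚ) (U : Set (Fin k → ℝ))
        (γ : ℝ → (Fin k → ℝ)) (a : Fin k → ℝ) (r : KZ.IntegralRep n),
      IsOpen U ∧ ContinuousOn γ (Set.Icc 0 1) ∧ γ 0 = 0 ∧ γ 1 = a ∧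
      (∀ t ∈ Set.Icc (0 : ℝ) 1, γ t ∈ U) ∧
      (∃ c₀ : ℚ, c₀ ≠ 0 ∧ ∀ z : Fin n → ℝ,
        MvPolynomial.aeval (Fin.append z (0 : Fin k → ℝ)) Q = (c₀ : ℝ)) ∧
      (∀ (z : Fin n → ℝ) (u : Fin k → ℝ), (∀ i, z i ∈ Set.Icc (0 : ℝ) 1) → u ∈ U →
        MvPolynomial.aeval (Fin.append z u) Q ≠ 0) ∧
      (∀ u ∈ U, ∫ z in Set.pi Set.univ (fun _ : Fin n => Set.Ioo (0 : ℝ) 1),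
        MvPolynomial.aeval (Fin.append z u) P / MvPolynomial.aeval (Fin.append z u) Q = 0) ∧
      (∀ j, IsAlgebraic ℚ (a j)) ∧
      r.domain = Set.pi Set.univ (fun _ : Fin n => Set.Ioo (0 : ℝ) 1) ∧
      Set.EqOn r.integrand (fun z => MvPolynomial.aeval (Fin.append z a) P /
        MvPolynomial.aeval (Fin.append z a) Q) r.domain ∧
      d = KZ.of r} ⊆
    {d : KZ.FormalRep | ∃ (n : ℕ) (P Q : MvPolynomial (Fin (n + 1)) ℚ) (ε ϖ₀ : ℝ)
        (r : KZ.IntegralRep n), 0 < ε ∧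
      (∃ c₀ : ℚ, c₀ ≠ 0 ∧ ∀ z : Fin n → ℝ,
        MvPolynomial.aeval (Fin.snoc z (0 : ℝ) : Fin (n + 1) → ℝ) Q = (c₀ : ℝ)) ∧
      (∀ (z : Fin n → ℝ) (ϖ : ℝ), (∀ i, z i ∈ Set.Icc (0 : ℝ) 1) → ϖ ∈ Set.Ioo 0 ε →
        MvPolynomial.aeval (Fin.snoc z ϖ : Fin (n + 1) → ℝ) Q ≠ 0) ∧
      (∀ ϖ ∈ Set.Ioo (0 : ℝ) ε, ∫ z in Set.pi Set.univ (fun _ : Fin n => Set.Ioo (0 : ℝ) 1),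
        MvPolynomial.aeval (Fin.snoc z ϖ : Fin (n + 1) → ℝ) P /
          MvPolynomial.aeval (Fin.snoc z ϖ : Fin (n + 1) → ℝ) Q = 0) ∧
      IsAlgebraic ℚ ϖ₀ ∧ ϖ₀ ∈ Set.Ioo 0 ε ∧
      r.domain = Set.pi Set.univ (fun _ : Fin n => Set.Ioo (0 : ℝ) 1) ∧
      Set.EqOn r.integrand (fun z => MvPolynomial.aeval (Fin.snoc z ϖ₀ : Fin (n + 1) → ℝ) P /
        MvPolynomial.aeval (Fin.snoc z ϖ₀ : Fin (n + 1) → ℝ) Q) r.domain ∧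
      d = KZ.of r} := by
  intro hCS hArc hSub d hd
  obtain ⟨n, k, P, Q, U, γ, a, r, hU, hγ, hγ0, hγ1, hγU, ⟨c₀, hc₀, hQ0⟩, hadm, hvan, halg, hdom,
    hint, rfl⟩ := hd
  -- (1) the corner shift `θ`
  obtain ⟨θ, hθalg, hθpos, hθiso, hq⟩ := hCS k a halg
  -- (2) reparametrise the path to `[0, θ]` and run the polynomial arc from the corner to `a`
  have hmaps : ∀ t ∈ Set.Icc (0 : ℝ) θ, t / θ ∈ Set.Icc (0 : ℝ) 1 := fun t ht =>
    ⟨div_nonneg ht.1 hθpos.le, div_le_one_of_le₀ ht.2 hθpos.le⟩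
  obtain ⟨p, hp0, hpθ, hpU⟩ := hArc k θ a U (fun t => γ (t / θ)) hθalg hθpos hθiso hq hU
    (hγ.comp (continuous_id.div_const θ).continuousOn hmaps)
    (by show γ (0 / θ) = 0; rw [zero_div, hγ0])
    (by show γ (θ / θ) = a; rw [div_self hθpos.ne', hγ1])
    (fun t ht => hγU _ (hmaps t ht))
  -- (3) a margin `δ > 0` beyond `θ`: the arc stays in `U` on `(0, θ + δ)`
  have haU : a ∈ U := by rw [← hγ1]; exact hγU 1 ⟨zero_le_one, le_rfl⟩
  have hpa : (fun j => Polynomial.aeval θ (p j)) = a := funext hpθ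
  have hpz : (fun j => Polynomial.aeval (0 : ℝ) (p j)) = (0 : Fin k → ℝ) := funext hp0
  have hcont : Continuous fun t : ℝ => fun j : Fin k => Polynomial.aeval t (p j) :=
    continuous_pi fun j => (p j).continuous_aeval
  have hpre : (fun t : ℝ => fun j : Fin k => Polynomial.aeval t (p j)) ⁻¹' U ∈ nhds θ :=
    hcont.continuousAt.preimage_mem_nhds
      (hU.mem_nhds (by rw [hpa]; exact haU : (fun j => Polynomial.aeval θ (p j)) ∈ U))
  obtain ⟨δ, hδpos, hball⟩ := Metric.mem_nhds_iff.mp hpre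
  have hφU : ∀ ϖ ∈ Set.Ioo (0 : ℝ) (θ + δ), (fun j => Polynomial.aeval ϖ (p j)) ∈ U := by
    intro ϖ hϖ
    rcases le_or_gt ϖ θ with h | h
    · exact hpU ϖ ⟨hϖ.1.le, h⟩
    · have hmem : ϖ ∈ Metric.ball θ δ := by
        rw [Metric.mem_ball, Real.dist_eq, abs_of_pos (sub_pos.mpr h)]
        linarith [hϖ.2]
      exact hball hmem
  -- (4) substitute the arc into `P` and `Q` and assemble the Tate fibre data
  obtain ⟨P', hP'⟩ := hSub n k p P
  obtain ⟨Q', hQ'⟩ := hSub n k p Q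
  refine ⟨n, P', Q', θ + δ, θ, r, add_pos hθpos hδpos, ⟨c₀, hc₀, fun z => ?_⟩,
    fun z ϖ hz hϖ => ?_, fun ϖ hϖ => ?_, hθalg, ⟨hθpos, lt_add_of_pos_right θ hδpos⟩, hdom,
    fun z hz => ?_, rfl⟩
  · rw [hQ' z 0, hpz]
    exact hQ0 z
  · rw [hQ' z ϖ]
    exact hadm z _ hz (hφU ϖ hϖ)
  · simp only [hP', hQ']
    exact hvan _ (hφU ϖ hϖ)
  · rw [hint hz]
    simp only [hP', hQ', hpa]

end Summit.KontsevichZagierPeriods.InverseLandau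

end
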